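import Summits.BirchSwinnertonDyer.BirchSwinnertonDyer.Theorems.PrintCf2RubinValueTwoEllipticUnitsTwoVariableMeasureDischargedSteps
import Summits.BirchSwinnertonDyer.BirchSwinnertonDyer.Theorems.PrintCf2RubinValueTwoKatzMeasureJZeroClassOneOfSeam
import Literature.NumberTheory.EllipticCurves.DeShalit1987.RayClassTowerDiagonalSplit
import HarnessLib

set_option linter.dupNamespace false
set_option autoImplicit false
/-!
# The (e)-ASSEMBLY, SUPPLY: `hsupply` (the one hypothesis of `…KatzMeasureJZeroClassOneOfSeam`, p764079) FROM THE LANE'S MEASURE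

Cell `bsd-print-cf2`, width seat `bsd-line-cf2-p1-w3` g31; print leaf 24720 `KatzDistributionsAtTwoPrint` (director OPTION 1, `j = 0` twin),
R3 endpoint `KatzMeasureTwo.lMeasureJZero_classNumberOne_two`.  `--supports stmt-BirchSwinnertonDyer-24720` (helper, Theses-free).  THEOREMS ONLY
(no `def`, no named fact, no `sorry`); CONDITIONAL on the four de Shalit II.2 prints (hypotheses); nothing is closed; no summit statement is
proved by this seat; BSD is not proved by any of this.

**`supply_of_chainSeam`**: `hsupply` holds GIVEN the prints and `hseam` = «for every frame and every LOCAL DATUM `(hq, h2, u, σ₀, ε, θ, e₂, …)`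
(the output of -w8 g11's D1 `exists_localDatum_of_principal_split`, ∀-bound) there are `Ω ≠ 0`, `Ω₂ ∈ R₀ˣ` such that for every `S ∌ v, v̄`
there is a one-prime-step chain `𝔣_k = 𝔪_k v̄^{b_k+1}` of the SUPPLIER's choice (e.g. -w5's `DeShalit1987.exists_roundRobin_chain[_uniform]`),
cofinal with the powers of `𝔤v̄`, such that for ALL per-chain data and every `μ` with `‖μ‖ = 1` and the twisting relations — the conclusion
of -w8's D2 `exists_twoVariableMeasure_of_principal_split_steps_of_localDatum` VERBATIM (with `ι := w₀.embedding`) — there is `μ′` on the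
same diagonal tower with `‖μ′‖ ≤ 1` satisfying p763661's `hsum` at `(Ω, Ω₂)`» (= de Shalit's `μ(𝔣) = μ_𝔞/(12δ_𝔞)`: the division by `12`,
II.2.7 / gap G4, and the identity (38)→(40) are exactly the content of `hseam`).  Proof: `h_K = 1 ⇒ v = (α₀)`, `w_{v̄²} = 1`
(-w5 `KatzJZeroUnique.units_eq_one_of_sub_one_mem_sq`), D1 ONCE before `S` (LEAD g19 ruling R-QO: `Ω, Ω₂` may depend on the datum), then per
`S`: the chain from `hseam`, D2, open levels and `⋂_n U_n ⊆ rayKer K 2 S` (-w5 g15 A1 `isOpen_diagonal_absRayAdicTower_U`,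
`iInter_diagonal_absRayAdicTower_subset_rayKer_of_finrank_eq_two`), `μ′` from `hseam`.
**`lMeasureJZero_classNumberOne_two_of_chainSeam`** = p764079 ∘ `supply_of_chainSeam`: THE R3 ENDPOINT VERBATIM from the four prints + `hseam`.

References: [deShalit1987] II.4.12 with Remarks (i)–(iv) (p. 66–69), II.4.14 (36)–(40) (p. 71–73), II.4.16 (49)–(50) (p. 76–77), II.2.7 (p. 49).
-/
noncomputable section
open scoped NumberField Classical nonZeroDivisors
open NumberField IsDedekindDomain Field
open IsDedekindDomain.HeightOneSpectrum ValuativeRel IsLocalRing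
open Literature Literature.NumberTheory.GaloisRepresentations Literature.NumberTheory.EllipticCurves
open Literature.NumberTheory.GaloisRepresentations.IsNonarchimedeanLocalField Literature.NumberTheory.GaloisRepresentations.LubinTate
  Literature.NumberTheory.GaloisRepresentations.ArtinLocalGlobal Literature.NumberTheory.PAdicHodge
open Literature.NumberTheory.LFunctions Literature.NumberTheory.NumberFields
open Literature.NumberTheory.EllipticCurves.GroupDistribution Literature.NumberTheory.ComplexMultiplication.EllipticUnits
open Literature.NumberTheory.LFunctions.AbelianDensity (artinSymbol)
open Literature.NumberTheory.EllipticCurves.DeShalit1987 Literature.NumberTheory.GaloisRepresentations.HeckeCharacter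
open Summit.BirchSwinnertonDyer.BirchSwinnertonDyer.Theorems.PrintCf2.EllipticUnitsLocal
  Summit.BirchSwinnertonDyer.BirchSwinnertonDyer.Theorems.PrintCf2.EllipticUnitsGlobal
  Summit.BirchSwinnertonDyer.BirchSwinnertonDyer.Theorems.PrintCf2.EllipticUnitsTwoVariable

namespace Summit.BirchSwinnertonDyer.BirchSwinnertonDyer.Theorems.PrintCf2.KatzMeasureJZeroTop

attribute [local instance] GlobalNormCoherentUnits.instCommMonoid GlobalNormCoherentUnits.galAction
attribute [local instance] ltNormUniformSpace ltNormIsUniformAddGroup rk1 nF nE fintypeResidueField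
attribute [local instance] RelNormCoherentUnits.instCommMonoid

set_option maxHeartbeats 1600000 in
/-- ★★ **`hsupply` FROM THE LANE'S MEASURE, modulo the normalised twisted class-sum identity per measure (`hseam`, module docstring)**:
D1 once, then per `S` the supplier's chain, D2, A1 (open levels, `⋂ ⊆ rayKer`), and `hseam`'s `μ′`.
[cite: deShalit1987, II.4.12 Remarks (i)–(iv) (p. 66–69), II.4.14 (36)–(40) (p. 71–73), II.4.16 (49)–(50) (p. 76–77)] -/
theorem supply_of_chainSeam
    (h24i : DeShalit1987.prop24_i_mem_rayClassField) (h24ii : DeShalit1987.prop24_ii_galoisAction)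
    (h24iii : DeShalit1987.prop24_iii_unit) (h25 : DeShalit1987.prop25_i_normRelation)
    (hseam : ∀ (K : Type) [Field K] [NumberField K] [IsTotallyComplex K]
      (hK : IsImaginaryQuadratic K) (_ : NumberField.classNumber K = 1)
      (ι : PadicAlgCl 2 ≃+* ℂ) (w₀ : InfinitePlace K) (v vbar : HeightOneSpectrum (𝓞 K))
        (hv2 : ((2 : ℕ) : 𝓞 K) ∈ v.asIdeal) (hvbar2 : ((2 : ℕ) : 𝓞 K) ∈ vbar.asIdeal) (hne : vbar ≠ v)
        (_ : ∀ (w : InfinitePlace K) (k : 𝓞 K), k ∈ v.asIdeal ↔ ‖ι.symm (w.embedding (k : K))‖ < 1)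
        {α₀ : 𝓞 K} (hv0 : v.asIdeal = Ideal.span {α₀})
        (hw2 : ∀ uu : (𝓞 K)ˣ, (uu : 𝓞 K) - 1 ∈ vbar.asIdeal ^ 2 → uu = 1)
    (hq : residueFieldCard (v.adicCompletion K) = 2)
    (h2 : (valuation (v.adicCompletion K)).IsUniformizer ((((2 : ℕ) : 𝒪[v.adicCompletion K]) : v.adicCompletion K)))
    (u : 𝒪[v.adicCompletion K]ˣ)
    (hu : ((((u : 𝒪[v.adicCompletion K]) * ((2 : ℕ) : 𝒪[v.adicCompletion K]) : 𝒪[v.adicCompletion K]) : v.adicCompletion K)) = ((α₀ : K) : v.adicCompletion K))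
    {σ₀ : absoluteGaloisGroup (v.adicCompletion K)} (hσ₀ : IsAbsArithFrob σ₀)
    {ε : (maxUnramifiedCompletion (v.adicCompletion K))ˣ}
    (hε : maxUnramifiedCompletion.galAut (v.adicCompletion K) σ₀ (ε : maxUnramifiedCompletion (v.adicCompletion K)) =
      algebraMap 𝒪[v.adicCompletion K] (maxUnramifiedCompletion (v.adicCompletion K)) (u : 𝒪[v.adicCompletion K]) * (ε : maxUnramifiedCompletion (v.adicCompletion K)))
    (θ : CompletedAlgClosure (v.adicCompletion K) →+* ℂ_[2])
    (hθ1 : ∀ z : CBall (v.adicCompletion K), ‖θ (z : CompletedAlgClosure (v.adicCompletion K))‖ ≤ 1)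
    (e₂ : v.adicCompletionIntegers K ≃+* ℤ_[2])
    (hΘe : ∀ a : 𝒪[v.adicCompletion K], (θ.comp ((CBall (v.adicCompletion K)).subtype.comp
        (algebraMap (UnrCoeff (v.adicCompletion K)) (CBall (v.adicCompletion K))))) (intToUnrCoeff (v.adicCompletion K) a) =
      padicIntCast ℂ_[2] (((e₂ : v.adicCompletionIntegers K →+* ℤ_[2]).comp (integerEquivAdicCompletionIntegers v).toRingHom) a))
        (_ : Continuous θ)
        (_ : ∀ ζ' : ℂ_[2], (∃ n : ℕ, ζ' ^ 2 ^ n = 1) →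
          ∃ ζ : CompletedAlgClosure (v.adicCompletion K), (∃ n : ℕ, ζ ^ 2 ^ n = 1) ∧ θ ζ = ζ')
        (_ : Function.Bijective θ) (_ : ∀ z : CompletedAlgClosure (v.adicCompletion K), ‖z‖ < 1 → ‖θ z‖ < 1),
      ∃ (Ω : ℂ) (Ωp : (unrIntegers 2)ˣ), Ω ≠ 0 ∧
      ∀ (S : Finset (HeightOneSpectrum (𝓞 K))), v ∉ S → vbar ∉ S →
      ∃ (𝔣 : ℕ → Ideal (𝓞 K)) (𝔩 : ℕ → HeightOneSpectrum (𝓞 K)) (𝔪c : ℕ → Ideal (𝓞 K)) (b : ℕ → ℕ)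
        (h𝔣succ : ∀ k, 𝔣 (k + 1) = 𝔣 k * (𝔩 k).asIdeal) (hdiv : ∀ k, (𝔩 k).asIdeal ∣ 𝔣 k)
        (_ : ∀ k, 𝔣 k = 𝔪c k * vbar.asIdeal ^ (b k + 1)) (_ : ∀ k, 1 ≤ b k)
        (_ : ∀ k, ¬ 𝔪c k ≤ v.asIdeal) (_ : ∀ k, ¬ 𝔪c k ≤ vbar.asIdeal)
        (_ : ∀ m : ℕ, ∃ n, 𝔣 n ≤ ((∏ w ∈ S, w.asIdeal) * vbar.asIdeal) ^ m),
    ∀ (h𝔣0 : ∀ m : ℕ, 𝔣 m ≠ ⊥) (h𝔣1 : ∀ m : ℕ, 𝔣 m ≠ ⊤)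
      (hvm : ∀ m : ℕ, ¬ 𝔣 m ≤ v.asIdeal)
      (hwm : ∀ (m : ℕ) (u : (𝓞 K)ˣ), (u : 𝓞 K) - 1 ∈ 𝔣 m → u = 1)
      (hle : ∀ m : ℕ, 𝔣 (m + 1) ≤ 𝔣 m)
      (α : ℕ → 𝓞 K) (hα0 : ∀ m, α m ≠ 0) (hα𝔣 : ∀ m, α m - 1 ∈ 𝔣 m)
      (hαw : ∀ (m : ℕ) (w : HeightOneSpectrum (𝓞 K)), w ≠ v → α m ∉ w.asIdeal)
      (f : ℕ → ℕ) (hαπ : ∀ m, ((α m : K) : v.adicCompletion K) =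
        ((((u : 𝒪[v.adicCompletion K]) * ((2 : ℕ) : 𝒪[v.adicCompletion K]) : 𝒪[v.adicCompletion K]) : v.adicCompletion K)) ^ f m)
      (E : ℕ → IntermediateField (v.adicCompletion K) (AlgebraicClosure (v.adicCompletion K)))
      (_ : ∀ m, FiniteDimensional (v.adicCompletion K) (E m)) (_ : ∀ m, IsGalois (v.adicCompletion K) (E m))
      (hE : ∀ m, E m ≤ maxUnramified (v.adicCompletion K))
      (hdegE : ∀ (m : ℕ) (w : WeilGroup (v.adicCompletion K)),
        WeilGroup.toAbsGalois (v.adicCompletion K) w ∈ (E m).fixingSubgroup → (f m : ℤ) ∣ WeilGroup.deg w)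
      (hEE : ∀ m, E m ≤ E (m + 1))
      (j : ∀ m : ℕ, unitBall (E m) →+* UnrCoeff (v.adicCompletion K))
      (_ : ∀ m, (j m).comp (algebraMap (LTCoeff (v.adicCompletion K)) (unitBall (E m))) =
        (intToUnrCoeff (v.adicCompletion K)).comp (LTCoeff.of (v.adicCompletion K)).symm.toRingHom)
      (hjC : ∀ m, (algebraMap (UnrCoeff (v.adicCompletion K)) (CBall (v.adicCompletion K))).comp (j m) = unitBallToCBall (E m))
      (_ : ∀ (m : ℕ) (y : unitBall (E m)), j (m + 1) (inclUnitBall (F := v.adicCompletion K) (hEE m) y) = j m y)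
      (ψ : ∀ m n : ℕ, ↥(absRestrictNormalHom (rayClassField K (𝔣 m))).ker ⧸
        (rayAdicTower (𝔪 := 𝔣 m) (h𝔣0 m) v).U n → ZMod (2 ^ (n + 1)))
      (hψ : ∀ (m n : ℕ) (g : ↥(absRestrictNormalHom (rayClassField K (𝔣 m))).ker),
        g ∈ (rayAdicTower (𝔪 := 𝔣 m) (h𝔣0 m) v).U 0 →
        ψ m n ((rayAdicTower (𝔪 := 𝔣 m) (h𝔣0 m) v).proj n g) =
          PadicInt.toZModPow (n + 1) ((((Units.map (e₂ : v.adicCompletionIntegers K →+* ℤ_[2]).toMonoidHom).comp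
            (rayAdicCharacter (h𝔣0 m) (hvm m) (hwm m)))⁻¹ g : ℤ_[2]ˣ) : ℤ_[2]))
      (g : {c : Ideal (𝓞 K) // c ≠ ⊥ ∧ IsCoprime c (𝔣 0 * v.asIdeal)} → absoluteGaloisGroup K)
      (_ : ∀ (c : {c : Ideal (𝓞 K) // c ≠ ⊥ ∧ IsCoprime c (𝔣 0 * v.asIdeal)}) (m k : ℕ),
        absRestrictNormalHom (rayClassField K (𝔣 m * v.asIdeal ^ (k + 1))) (g c) =
          artinSymbol (galFrob K (rayClassField K (𝔣 m * v.asIdeal ^ (k + 1)))) c.1)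
      (x : ∀ (_ : {c : Ideal (𝓞 K) // c ≠ ⊥ ∧ IsCoprime c (𝔣 0 * v.asIdeal)}) (m k : ℕ),
        rayClassField K (𝔣 m * v.asIdeal ^ (k + 1)))
      (hx : ∀ (c : {c : Ideal (𝓞 K) // c ≠ ⊥ ∧ IsCoprime c (𝔣 0 * v.asIdeal)}) (m k : ℕ),
        IsThetaValueOne w₀.embedding (𝔣 m * v.asIdeal ^ (k + 1)) c.1
          (algClosureEmb w₀.embedding ((x c m k : rayClassField K (𝔣 m * v.asIdeal ^ (k + 1))) : AlgebraicClosure K)))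
      (_ : ∀ m n, ((rayAdicTower (𝔪 := 𝔣 m) (h𝔣0 m) v).U n).Normal)
      (_ : ∀ m n, ((absRayAdicTower (𝔪' := 𝔣 m) (h𝔣0 m) v).U n).Normal)
      (μ : GroupDistribution (SubgroupTower.diagonal (fun m ↦ absRayAdicTower (𝔪' := 𝔣 m) (h𝔣0 m) v)
        (fun m n ↦ absRayAdicTower_U_anti (h𝔣0 m) (h𝔣0 (m + 1)) v (hle m) n)) ℂ_[2]),
      μ.bound = 1 →
      (∀ (c : {c : Ideal (𝓞 K) // c ≠ ⊥ ∧ IsCoprime c (𝔣 0 * v.asIdeal)}) (n : ℕ)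
        (b : absoluteGaloisGroup K ⧸ (absRayAdicTower (𝔪' := 𝔣 n) (h𝔣0 n) v).U n),
        (twisting (g c) (Ideal.absNorm c.1 : ℂ_[2]) μ).μ n b =
        (GroupDistribution.induceFrom (Γ := absoluteGaloisGroup K)
          (fun k ↦ rayAdicTower_U_eq_subgroupOf (𝔪 := 𝔣 n) (h𝔣0 n) v k)
          (fun b : GlobalNormCoherentUnits (h𝔣0 n) v ↦
            localMeasureFamily (h𝔣0 n) (hvm n) (hwm n) hq h2 u (E n) (hE n) hσ₀ hε θ hθ1 (j n) (hjC n) e₂ (ψ n) (hψ n)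
              (RelNormCoherentUnits.ofGlobalUnits (h𝔣0 n) (hvm n) (hwm n) (isUniformizer_unit_mul h2 u) (hα0 n) (hα𝔣 n) (hαw n)
                (hαπ n) (E n) (hE n) (hdegE n) b))
          zero_le_one (fun _ ↦ le_rfl)
          (ellipticUnitsGlobal h24iii h25 hK w₀.embedding (h𝔣0 n) (h𝔣1 n) (hvm n) (hwm n) c.2.1 (isCoprime_chain 𝔣 𝔩 h𝔣succ hdiv c.2.2 n)
            (x c n) (hx c n))).μ n b) →
      ∃ μ' : GroupDistribution (SubgroupTower.diagonal (fun m ↦ absRayAdicTower (𝔪' := 𝔣 m) (h𝔣0 m) v)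
        (fun m n ↦ absRayAdicTower_U_anti (h𝔣0 m) (h𝔣0 (m + 1)) v (hle m) n)) ℂ_[2],
        μ'.bound ≤ 1 ∧
        ∃ M₁ : ℕ, ∀ (w₁ : InfinitePlace K) (lam : HeckeCharacter K) (M : ℕ), M₁ ≤ M →
          lam.HasInfinityType (fun _ ↦ 1) (fun _ ↦ 0) →
          lam.IsModulus (insert vbar S) (fun _ ↦ M) →
          modulusIdeal (insert vbar S) (fun _ ↦ M) ≠ ⊤ →
          (∀ uu : (𝓞 K)ˣ, (uu : 𝓞 K) - 1 ∈ modulusIdeal (insert vbar S) (fun _ ↦ M) → uu = 1) →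
          ∀ (χ : HeightOneSpectrum (𝓞 K) → ℂ), IsRayClassCharacter (modulusIdeal (insert vbar S) (fun _ ↦ M)) χ →
          ∀ (𝔠 : Ideal (𝓞 K)), 𝔠 ≠ ⊥ → IsCoprime 𝔠 (modulusIdeal (insert vbar S) (fun _ ↦ M)) →
            IsCoprime 𝔠 v.asIdeal →
          ∀ (εH : HeckeCharacter K) (eH : FramedGaloisRep K (PadicAlgCl 2) 1) (m : ℕ),
            IsPAdicAvatarOutside S ι εH eH → 3 ≤ m →
            εH.HasInfinityType (fun _ ↦ -(m : ℤ)) (fun _ ↦ 0) →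
            (∀ w : HeightOneSpectrum (𝓞 K), w ∉ S → w ≠ vbar → εH.IsUnramifiedAt w) →
            (SubgroupTower.diagonal (fun m ↦ absRayAdicTower (𝔪' := 𝔣 m) (h𝔣0 m) v)
                (fun m n ↦ absRayAdicTower_U_anti (h𝔣0 m) (h𝔣0 (m + 1)) v (hle m) n)).IsTowerContinuous (fun σ ↦ avatarValueAt eH σ) →
            (∀ w : HeightOneSpectrum (𝓞 K), ¬ modulusIdeal (insert vbar S) (fun _ ↦ M) ≤ w.asIdeal →
              εH.valueAtUniformizer w = (χ w)⁻¹ * (lam.valueAtUniformizer w ^ m)⁻¹) →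
            ∀ hL : LFunction.HasEntireContinuation (heckeLFunction εH),
            ∃ (T : Finset (Ideal (𝓞 K))) (L : Ideal (𝓞 K) → PeriodPair),
              IsRayClassReps (modulusIdeal (insert vbar S) (fun _ ↦ M)) T ∧
              (∀ 𝔟 ∈ T, ∀ z : ℂ, z ∈ (L 𝔟).lattice ↔
                ∃ x ∈ ((modulusIdeal (insert vbar S) (fun _ ↦ M) : FractionalIdeal (𝓞 K)⁰ K) /
                  (𝔟 : FractionalIdeal (𝓞 K)⁰ K)), z = Ω * w₁.embedding x) ∧
              (∀ 𝔟 ∈ T, ∀ z : ℂ, z ∈ (L (𝔠 * 𝔟)).lattice ↔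
                ∃ x ∈ ((modulusIdeal (insert vbar S) (fun _ ↦ M) : FractionalIdeal (𝓞 K)⁰ K) /
                  ((𝔠 * 𝔟 : Ideal (𝓞 K)) : FractionalIdeal (𝓞 K)⁰ K)), z = Ω * w₁.embedding x) ∧
              ((Ideal.absNorm 𝔠 : ℂ_[2]) -
                  ((ι.symm (idealPow K χ 𝔠 * idealPow K (fun w ↦ lam.valueAtUniformizer w) 𝔠 ^ m) : PadicAlgCl 2) :
                    ℂ_[2])) * μ'.integral (fun σ ↦ avatarValueAt eH σ) =
                ((ι.symm ((1 - (εH.valueAtUniformizer v)⁻¹ * (((2 : ℕ) : ℂ))⁻¹) *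
                    ∑ 𝔟 ∈ T, (idealPow K χ 𝔟)⁻¹ * (idealPow K (fun w ↦ lam.valueAtUniformizer w) 𝔟 ^ m)⁻¹ *
                      ((Ideal.absNorm 𝔠 : ℂ) * (L 𝔟).eisensteinE m Ω - (L (𝔠 * 𝔟)).eisensteinE m Ω)) : PadicAlgCl 2) :
                  ℂ_[2]) * ((Ωp : unrIntegers 2) : ℂ_[2]) ^ m) :
    ∀ (K : Type) [Field K] [NumberField K], IsImaginaryQuadratic K → NumberField.classNumber K = 1 →
      ∀ (ι : PadicAlgCl 2 ≃+* ℂ) (v vbar : HeightOneSpectrum (𝓞 K)),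
        ((2 : ℕ) : 𝓞 K) ∈ v.asIdeal → ((2 : ℕ) : 𝓞 K) ∈ vbar.asIdeal → vbar ≠ v →
        (∀ (w : InfinitePlace K) (k : 𝓞 K), k ∈ v.asIdeal ↔ ‖ι.symm (w.embedding (k : K))‖ < 1) →
      ∃ (Ω : ℂ) (Ωp : (unrIntegers 2)ˣ), Ω ≠ 0 ∧
        ∀ (S : Finset (HeightOneSpectrum (𝓞 K))), v ∉ S → vbar ∉ S →
          ∃ (𝒰 : SubgroupTower (absoluteGaloisGroup K)) (μ : GroupDistribution 𝒰 ℂ_[2]),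
            (∀ n, IsOpen (𝒰.U n : Set (absoluteGaloisGroup K))) ∧
            (⋂ n, (𝒰.U n : Set (absoluteGaloisGroup K))) ⊆ DeShalit1987.rayKer K 2 S ∧
            μ.bound ≤ 1 ∧
            ∃ M₁ : ℕ, ∀ (w₁ : InfinitePlace K) (lam : HeckeCharacter K) (M : ℕ), M₁ ≤ M →
              lam.HasInfinityType (fun _ ↦ 1) (fun _ ↦ 0) →
              lam.IsModulus (insert vbar S) (fun _ ↦ M) →
              modulusIdeal (insert vbar S) (fun _ ↦ M) ≠ ⊤ →
              (∀ uu : (𝓞 K)ˣ, (uu : 𝓞 K) - 1 ∈ modulusIdeal (insert vbar S) (fun _ ↦ M) → uu = 1) →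
              ∀ (χ : HeightOneSpectrum (𝓞 K) → ℂ), IsRayClassCharacter (modulusIdeal (insert vbar S) (fun _ ↦ M)) χ →
              ∀ (𝔠 : Ideal (𝓞 K)), 𝔠 ≠ ⊥ → IsCoprime 𝔠 (modulusIdeal (insert vbar S) (fun _ ↦ M)) →
                IsCoprime 𝔠 v.asIdeal →
              ∀ (εH : HeckeCharacter K) (eH : FramedGaloisRep K (PadicAlgCl 2) 1) (m : ℕ),
                IsPAdicAvatarOutside S ι εH eH → 3 ≤ m →
                εH.HasInfinityType (fun _ ↦ -(m : ℤ)) (fun _ ↦ 0) →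
                (∀ w : HeightOneSpectrum (𝓞 K), w ∉ S → w ≠ vbar → εH.IsUnramifiedAt w) →
                𝒰.IsTowerContinuous (fun σ ↦ avatarValueAt eH σ) →
                (∀ w : HeightOneSpectrum (𝓞 K), ¬ modulusIdeal (insert vbar S) (fun _ ↦ M) ≤ w.asIdeal →
                  εH.valueAtUniformizer w = (χ w)⁻¹ * (lam.valueAtUniformizer w ^ m)⁻¹) →
                ∀ hL : LFunction.HasEntireContinuation (heckeLFunction εH),
                ∃ (T : Finset (Ideal (𝓞 K))) (L : Ideal (𝓞 K) → PeriodPair),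
                  IsRayClassReps (modulusIdeal (insert vbar S) (fun _ ↦ M)) T ∧
                  (∀ 𝔟 ∈ T, ∀ z : ℂ, z ∈ (L 𝔟).lattice ↔
                    ∃ x ∈ ((modulusIdeal (insert vbar S) (fun _ ↦ M) : FractionalIdeal (𝓞 K)⁰ K) /
                      (𝔟 : FractionalIdeal (𝓞 K)⁰ K)), z = Ω * w₁.embedding x) ∧
                  (∀ 𝔟 ∈ T, ∀ z : ℂ, z ∈ (L (𝔠 * 𝔟)).lattice ↔
                    ∃ x ∈ ((modulusIdeal (insert vbar S) (fun _ ↦ M) : FractionalIdeal (𝓞 K)⁰ K) /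
                      ((𝔠 * 𝔟 : Ideal (𝓞 K)) : FractionalIdeal (𝓞 K)⁰ K)), z = Ω * w₁.embedding x) ∧
                  ((Ideal.absNorm 𝔠 : ℂ_[2]) -
                      ((ι.symm (idealPow K χ 𝔠 * idealPow K (fun w ↦ lam.valueAtUniformizer w) 𝔠 ^ m) : PadicAlgCl 2) :
                        ℂ_[2])) * μ.integral (fun σ ↦ avatarValueAt eH σ) =
                    ((ι.symm ((1 - (εH.valueAtUniformizer v)⁻¹ * (((2 : ℕ) : ℂ))⁻¹) *
                        ∑ 𝔟 ∈ T, (idealPow K χ 𝔟)⁻¹ * (idealPow K (fun w ↦ lam.valueAtUniformizer w) 𝔟 ^ m)⁻¹ *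
                          ((Ideal.absNorm 𝔠 : ℂ) * (L 𝔟).eisensteinE m Ω - (L (𝔠 * 𝔟)).eisensteinE m Ω)) : PadicAlgCl 2) :
                      ℂ_[2]) * ((Ωp : unrIntegers 2) : ℂ_[2]) ^ m := by
  intro K _ _ hK hh ι v vbar hv hvbar hne hι
  classical
  haveI : IsTotallyComplex K := hK.2
  haveI : IsPrincipalIdealRing (𝓞 K) := NumberField.classNumber_eq_one_iff.mp hh
  -- the unique infinite place
  obtain ⟨w₀⟩ : Nonempty (InfinitePlace K) := inferInstance
  have hw₀ : ∀ w : InfinitePlace K, w = w₀ := by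
    haveI := subsingleton_infinitePlace_of_finrank_eq_two (K := K) hK.1
    exact fun w ↦ Subsingleton.elim w w₀
  -- `v = (α₀)` (`h_K = 1`) and `w_{v̄²} = 1`
  obtain ⟨α₀, hv0⟩ := (IsPrincipalIdealRing.principal v.asIdeal).principal
  have hw2 : ∀ uu : (𝓞 K)ˣ, (uu : 𝓞 K) - 1 ∈ vbar.asIdeal ^ 2 → uu = 1 :=
    KatzJZeroUnique.units_eq_one_of_sub_one_mem_sq (padicIntEquivOfSplit K hK.1 hvbar hv hne.symm) hw₀
  -- D1: the local datum, ONCE (before `S`)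
  obtain ⟨hq, h2, u, hu, σ₀, hσ₀, ε, hε, θ, hθc, hθ1, hθζ, e₂, hΘe, hθb, hθlt⟩ :=
    exists_localDatum_of_principal_split hK hv hvbar hne hv0
  obtain ⟨Ω, Ωp, hΩ, hS⟩ := hseam K hK hh ι w₀ v vbar hv hvbar hne hι hv0 hw2 hq h2 u hu hσ₀ hε θ hθ1 e₂ hΘe
    hθc hθζ hθb hθlt
  refine ⟨Ω, Ωp, hΩ, fun S hvS hvbarS ↦ ?_⟩
  obtain ⟨𝔣, 𝔩, 𝔪c, b, h𝔣succ, hdiv, h𝔣eq, hb, h𝔪v, h𝔪vbar, hcof, hrest⟩ := hS S hvS hvbarS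
  -- D2: the measure along the chain
  obtain ⟨h𝔣0, h𝔣1, hvm, hwm, hle, α, hα0, hα𝔣, hαw, f, hαπ, E, hfd, hgal, hE, hdegE, hEE, j, hj, hjC, hjj, ψ, hψ, g, hg, x, hx,
    hN, hNabs, μ, hbd, hμ⟩ :=
    exists_twoVariableMeasure_of_principal_split_steps_of_localDatum h24i h24ii h24iii h25 hK w₀.embedding 𝔣 𝔩 h𝔣succ hdiv 𝔪c b
      h𝔣eq hb h𝔪v h𝔪vbar hw2 hv hvbar hne hv0 hq h2 u hu hσ₀ hε θ hθ1 e₂ hΘe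
  obtain ⟨μ', hbd', hsum'⟩ := hrest h𝔣0 h𝔣1 hvm hwm hle α hα0 hα𝔣 hαw f hαπ E hfd hgal hE hdegE hEE j hj hjC hjj ψ hψ g hg x hx
    hN hNabs μ hbd hμ
  refine ⟨_, μ', ?_, ?_, hbd', hsum'⟩
  · exact fun n ↦ DeShalit1987.isOpen_diagonal_absRayAdicTower_U h𝔣0 v _ n
  · exact DeShalit1987.iInter_diagonal_absRayAdicTower_subset_rayKer_of_finrank_eq_two 2 S h𝔣0 _ hK.1 hv hvbar hne hle hcof

/-- ★★ **THE R3 ENDPOINT from the four de Shalit II.2 prints and the analytic seam `hseam`** (p764079 ∘ `supply_of_chainSeam`).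
[cite: deShalit1987, II Thm. 4.14 (36) (p. 71), II.4.12 (p. 66–69), II.4.16 (49)–(50) (p. 76–77)] -/
theorem lMeasureJZero_classNumberOne_two_of_chainSeam
    (h24i : DeShalit1987.prop24_i_mem_rayClassField) (h24ii : DeShalit1987.prop24_ii_galoisAction)
    (h24iii : DeShalit1987.prop24_iii_unit) (h25 : DeShalit1987.prop25_i_normRelation)
    (hseam : ∀ (K : Type) [Field K] [NumberField K] [IsTotallyComplex K]
      (hK : IsImaginaryQuadratic K) (_ : NumberField.classNumber K = 1)
      (ι : PadicAlgCl 2 ≃+* ℂ) (w₀ : InfinitePlace K) (v vbar : HeightOneSpectrum (𝓞 K))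
        (hv2 : ((2 : ℕ) : 𝓞 K) ∈ v.asIdeal) (hvbar2 : ((2 : ℕ) : 𝓞 K) ∈ vbar.asIdeal) (hne : vbar ≠ v)
        (_ : ∀ (w : InfinitePlace K) (k : 𝓞 K), k ∈ v.asIdeal ↔ ‖ι.symm (w.embedding (k : K))‖ < 1)
        {α₀ : 𝓞 K} (hv0 : v.asIdeal = Ideal.span {α₀})
        (hw2 : ∀ uu : (𝓞 K)ˣ, (uu : 𝓞 K) - 1 ∈ vbar.asIdeal ^ 2 → uu = 1)
    (hq : residueFieldCard (v.adicCompletion K) = 2)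
    (h2 : (valuation (v.adicCompletion K)).IsUniformizer ((((2 : ℕ) : 𝒪[v.adicCompletion K]) : v.adicCompletion K)))
    (u : 𝒪[v.adicCompletion K]ˣ)
    (hu : ((((u : 𝒪[v.adicCompletion K]) * ((2 : ℕ) : 𝒪[v.adicCompletion K]) : 𝒪[v.adicCompletion K]) : v.adicCompletion K)) = ((α₀ : K) : v.adicCompletion K))
    {σ₀ : absoluteGaloisGroup (v.adicCompletion K)} (hσ₀ : IsAbsArithFrob σ₀)
    {ε : (maxUnramifiedCompletion (v.adicCompletion K))ˣ}
    (hε : maxUnramifiedCompletion.galAut (v.adicCompletion K) σ₀ (ε : maxUnramifiedCompletion (v.adicCompletion K)) =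
      algebraMap 𝒪[v.adicCompletion K] (maxUnramifiedCompletion (v.adicCompletion K)) (u : 𝒪[v.adicCompletion K]) * (ε : maxUnramifiedCompletion (v.adicCompletion K)))
    (θ : CompletedAlgClosure (v.adicCompletion K) →+* ℂ_[2])
    (hθ1 : ∀ z : CBall (v.adicCompletion K), ‖θ (z : CompletedAlgClosure (v.adicCompletion K))‖ ≤ 1)
    (e₂ : v.adicCompletionIntegers K ≃+* ℤ_[2])
    (hΘe : ∀ a : 𝒪[v.adicCompletion K], (θ.comp ((CBall (v.adicCompletion K)).subtype.comp
        (algebraMap (UnrCoeff (v.adicCompletion K)) (CBall (v.adicCompletion K))))) (intToUnrCoeff (v.adicCompletion K) a) =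
      padicIntCast ℂ_[2] (((e₂ : v.adicCompletionIntegers K →+* ℤ_[2]).comp (integerEquivAdicCompletionIntegers v).toRingHom) a))
        (_ : Continuous θ)
        (_ : ∀ ζ' : ℂ_[2], (∃ n : ℕ, ζ' ^ 2 ^ n = 1) →
          ∃ ζ : CompletedAlgClosure (v.adicCompletion K), (∃ n : ℕ, ζ ^ 2 ^ n = 1) ∧ θ ζ = ζ')
        (_ : Function.Bijective θ) (_ : ∀ z : CompletedAlgClosure (v.adicCompletion K), ‖z‖ < 1 → ‖θ z‖ < 1),
      ∃ (Ω : ℂ) (Ωp : (unrIntegers 2)ˣ), Ω ≠ 0 ∧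
      ∀ (S : Finset (HeightOneSpectrum (𝓞 K))), v ∉ S → vbar ∉ S →
      ∃ (𝔣 : ℕ → Ideal (𝓞 K)) (𝔩 : ℕ → HeightOneSpectrum (𝓞 K)) (𝔪c : ℕ → Ideal (𝓞 K)) (b : ℕ → ℕ)
        (h𝔣succ : ∀ k, 𝔣 (k + 1) = 𝔣 k * (𝔩 k).asIdeal) (hdiv : ∀ k, (𝔩 k).asIdeal ∣ 𝔣 k)
        (_ : ∀ k, 𝔣 k = 𝔪c k * vbar.asIdeal ^ (b k + 1)) (_ : ∀ k, 1 ≤ b k)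
        (_ : ∀ k, ¬ 𝔪c k ≤ v.asIdeal) (_ : ∀ k, ¬ 𝔪c k ≤ vbar.asIdeal)
        (_ : ∀ m : ℕ, ∃ n, 𝔣 n ≤ ((∏ w ∈ S, w.asIdeal) * vbar.asIdeal) ^ m),
    ∀ (h𝔣0 : ∀ m : ℕ, 𝔣 m ≠ ⊥) (h𝔣1 : ∀ m : ℕ, 𝔣 m ≠ ⊤)
      (hvm : ∀ m : ℕ, ¬ 𝔣 m ≤ v.asIdeal)
      (hwm : ∀ (m : ℕ) (u : (𝓞 K)ˣ), (u : 𝓞 K) - 1 ∈ 𝔣 m → u = 1)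
      (hle : ∀ m : ℕ, 𝔣 (m + 1) ≤ 𝔣 m)
      (α : ℕ → 𝓞 K) (hα0 : ∀ m, α m ≠ 0) (hα𝔣 : ∀ m, α m - 1 ∈ 𝔣 m)
      (hαw : ∀ (m : ℕ) (w : HeightOneSpectrum (𝓞 K)), w ≠ v → α m ∉ w.asIdeal)
      (f : ℕ → ℕ) (hαπ : ∀ m, ((α m : K) : v.adicCompletion K) =
        ((((u : 𝒪[v.adicCompletion K]) * ((2 : ℕ) : 𝒪[v.adicCompletion K]) : 𝒪[v.adicCompletion K]) : v.adicCompletion K)) ^ f m)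
      (E : ℕ → IntermediateField (v.adicCompletion K) (AlgebraicClosure (v.adicCompletion K)))
      (_ : ∀ m, FiniteDimensional (v.adicCompletion K) (E m)) (_ : ∀ m, IsGalois (v.adicCompletion K) (E m))
      (hE : ∀ m, E m ≤ maxUnramified (v.adicCompletion K))
      (hdegE : ∀ (m : ℕ) (w : WeilGroup (v.adicCompletion K)),
        WeilGroup.toAbsGalois (v.adicCompletion K) w ∈ (E m).fixingSubgroup → (f m : ℤ) ∣ WeilGroup.deg w)
      (hEE : ∀ m, E m ≤ E (m + 1))
      (j : ∀ m : ℕ, unitBall (E m) →+* UnrCoeff (v.adicCompletion K))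
      (_ : ∀ m, (j m).comp (algebraMap (LTCoeff (v.adicCompletion K)) (unitBall (E m))) =
        (intToUnrCoeff (v.adicCompletion K)).comp (LTCoeff.of (v.adicCompletion K)).symm.toRingHom)
      (hjC : ∀ m, (algebraMap (UnrCoeff (v.adicCompletion K)) (CBall (v.adicCompletion K))).comp (j m) = unitBallToCBall (E m))
      (_ : ∀ (m : ℕ) (y : unitBall (E m)), j (m + 1) (inclUnitBall (F := v.adicCompletion K) (hEE m) y) = j m y)
      (ψ : ∀ m n : ℕ, ↥(absRestrictNormalHom (rayClassField K (𝔣 m))).ker ⧸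
        (rayAdicTower (𝔪 := 𝔣 m) (h𝔣0 m) v).U n → ZMod (2 ^ (n + 1)))
      (hψ : ∀ (m n : ℕ) (g : ↥(absRestrictNormalHom (rayClassField K (𝔣 m))).ker),
        g ∈ (rayAdicTower (𝔪 := 𝔣 m) (h𝔣0 m) v).U 0 →
        ψ m n ((rayAdicTower (𝔪 := 𝔣 m) (h𝔣0 m) v).proj n g) =
          PadicInt.toZModPow (n + 1) ((((Units.map (e₂ : v.adicCompletionIntegers K →+* ℤ_[2]).toMonoidHom).comp
            (rayAdicCharacter (h𝔣0 m) (hvm m) (hwm m)))⁻¹ g : ℤ_[2]ˣ) : ℤ_[2]))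
      (g : {c : Ideal (𝓞 K) // c ≠ ⊥ ∧ IsCoprime c (𝔣 0 * v.asIdeal)} → absoluteGaloisGroup K)
      (_ : ∀ (c : {c : Ideal (𝓞 K) // c ≠ ⊥ ∧ IsCoprime c (𝔣 0 * v.asIdeal)}) (m k : ℕ),
        absRestrictNormalHom (rayClassField K (𝔣 m * v.asIdeal ^ (k + 1))) (g c) =
          artinSymbol (galFrob K (rayClassField K (𝔣 m * v.asIdeal ^ (k + 1)))) c.1)
      (x : ∀ (_ : {c : Ideal (𝓞 K) // c ≠ ⊥ ∧ IsCoprime c (𝔣 0 * v.asIdeal)}) (m k : ℕ),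
        rayClassField K (𝔣 m * v.asIdeal ^ (k + 1)))
      (hx : ∀ (c : {c : Ideal (𝓞 K) // c ≠ ⊥ ∧ IsCoprime c (𝔣 0 * v.asIdeal)}) (m k : ℕ),
        IsThetaValueOne w₀.embedding (𝔣 m * v.asIdeal ^ (k + 1)) c.1
          (algClosureEmb w₀.embedding ((x c m k : rayClassField K (𝔣 m * v.asIdeal ^ (k + 1))) : AlgebraicClosure K)))
      (_ : ∀ m n, ((rayAdicTower (𝔪 := 𝔣 m) (h𝔣0 m) v).U n).Normal)
      (_ : ∀ m n, ((absRayAdicTower (𝔪' := 𝔣 m) (h𝔣0 m) v).U n).Normal)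
      (μ : GroupDistribution (SubgroupTower.diagonal (fun m ↦ absRayAdicTower (𝔪' := 𝔣 m) (h𝔣0 m) v)
        (fun m n ↦ absRayAdicTower_U_anti (h𝔣0 m) (h𝔣0 (m + 1)) v (hle m) n)) ℂ_[2]),
      μ.bound = 1 →
      (∀ (c : {c : Ideal (𝓞 K) // c ≠ ⊥ ∧ IsCoprime c (𝔣 0 * v.asIdeal)}) (n : ℕ)
        (b : absoluteGaloisGroup K ⧸ (absRayAdicTower (𝔪' := 𝔣 n) (h𝔣0 n) v).U n),
        (twisting (g c) (Ideal.absNorm c.1 : ℂ_[2]) μ).μ n b =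
        (GroupDistribution.induceFrom (Γ := absoluteGaloisGroup K)
          (fun k ↦ rayAdicTower_U_eq_subgroupOf (𝔪 := 𝔣 n) (h𝔣0 n) v k)
          (fun b : GlobalNormCoherentUnits (h𝔣0 n) v ↦
            localMeasureFamily (h𝔣0 n) (hvm n) (hwm n) hq h2 u (E n) (hE n) hσ₀ hε θ hθ1 (j n) (hjC n) e₂ (ψ n) (hψ n)
              (RelNormCoherentUnits.ofGlobalUnits (h𝔣0 n) (hvm n) (hwm n) (isUniformizer_unit_mul h2 u) (hα0 n) (hα𝔣 n) (hαw n)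
                (hαπ n) (E n) (hE n) (hdegE n) b))
          zero_le_one (fun _ ↦ le_rfl)
          (ellipticUnitsGlobal h24iii h25 hK w₀.embedding (h𝔣0 n) (h𝔣1 n) (hvm n) (hwm n) c.2.1 (isCoprime_chain 𝔣 𝔩 h𝔣succ hdiv c.2.2 n)
            (x c n) (hx c n))).μ n b) →
      ∃ μ' : GroupDistribution (SubgroupTower.diagonal (fun m ↦ absRayAdicTower (𝔪' := 𝔣 m) (h𝔣0 m) v)
        (fun m n ↦ absRayAdicTower_U_anti (h𝔣0 m) (h𝔣0 (m + 1)) v (hle m) n)) ℂ_[2],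
        μ'.bound ≤ 1 ∧
        ∃ M₁ : ℕ, ∀ (w₁ : InfinitePlace K) (lam : HeckeCharacter K) (M : ℕ), M₁ ≤ M →
          lam.HasInfinityType (fun _ ↦ 1) (fun _ ↦ 0) →
          lam.IsModulus (insert vbar S) (fun _ ↦ M) →
          modulusIdeal (insert vbar S) (fun _ ↦ M) ≠ ⊤ →
          (∀ uu : (𝓞 K)ˣ, (uu : 𝓞 K) - 1 ∈ modulusIdeal (insert vbar S) (fun _ ↦ M) → uu = 1) →
          ∀ (χ : HeightOneSpectrum (𝓞 K) → ℂ), IsRayClassCharacter (modulusIdeal (insert vbar S) (fun _ ↦ M)) χ →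
          ∀ (𝔠 : Ideal (𝓞 K)), 𝔠 ≠ ⊥ → IsCoprime 𝔠 (modulusIdeal (insert vbar S) (fun _ ↦ M)) →
            IsCoprime 𝔠 v.asIdeal →
          ∀ (εH : HeckeCharacter K) (eH : FramedGaloisRep K (PadicAlgCl 2) 1) (m : ℕ),
            IsPAdicAvatarOutside S ι εH eH → 3 ≤ m →
            εH.HasInfinityType (fun _ ↦ -(m : ℤ)) (fun _ ↦ 0) →
            (∀ w : HeightOneSpectrum (𝓞 K), w ∉ S → w ≠ vbar → εH.IsUnramifiedAt w) →
            (SubgroupTower.diagonal (fun m ↦ absRayAdicTower (𝔪' := 𝔣 m) (h𝔣0 m) v)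
                (fun m n ↦ absRayAdicTower_U_anti (h𝔣0 m) (h𝔣0 (m + 1)) v (hle m) n)).IsTowerContinuous (fun σ ↦ avatarValueAt eH σ) →
            (∀ w : HeightOneSpectrum (𝓞 K), ¬ modulusIdeal (insert vbar S) (fun _ ↦ M) ≤ w.asIdeal →
              εH.valueAtUniformizer w = (χ w)⁻¹ * (lam.valueAtUniformizer w ^ m)⁻¹) →
            ∀ hL : LFunction.HasEntireContinuation (heckeLFunction εH),
            ∃ (T : Finset (Ideal (𝓞 K))) (L : Ideal (𝓞 K) → PeriodPair),
              IsRayClassReps (modulusIdeal (insert vbar S) (fun _ ↦ M)) T ∧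
              (∀ 𝔟 ∈ T, ∀ z : ℂ, z ∈ (L 𝔟).lattice ↔
                ∃ x ∈ ((modulusIdeal (insert vbar S) (fun _ ↦ M) : FractionalIdeal (𝓞 K)⁰ K) /
                  (𝔟 : FractionalIdeal (𝓞 K)⁰ K)), z = Ω * w₁.embedding x) ∧
              (∀ 𝔟 ∈ T, ∀ z : ℂ, z ∈ (L (𝔠 * 𝔟)).lattice ↔
                ∃ x ∈ ((modulusIdeal (insert vbar S) (fun _ ↦ M) : FractionalIdeal (𝓞 K)⁰ K) /
                  ((𝔠 * 𝔟 : Ideal (𝓞 K)) : FractionalIdeal (𝓞 K)⁰ K)), z = Ω * w₁.embedding x) ∧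
              ((Ideal.absNorm 𝔠 : ℂ_[2]) -
                  ((ι.symm (idealPow K χ 𝔠 * idealPow K (fun w ↦ lam.valueAtUniformizer w) 𝔠 ^ m) : PadicAlgCl 2) :
                    ℂ_[2])) * μ'.integral (fun σ ↦ avatarValueAt eH σ) =
                ((ι.symm ((1 - (εH.valueAtUniformizer v)⁻¹ * (((2 : ℕ) : ℂ))⁻¹) *
                    ∑ 𝔟 ∈ T, (idealPow K χ 𝔟)⁻¹ * (idealPow K (fun w ↦ lam.valueAtUniformizer w) 𝔟 ^ m)⁻¹ *
                      ((Ideal.absNorm 𝔠 : ℂ) * (L 𝔟).eisensteinE m Ω - (L (𝔠 * 𝔟)).eisensteinE m Ω)) : PadicAlgCl 2) :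
                  ℂ_[2]) * ((Ωp : unrIntegers 2) : ℂ_[2]) ^ m) :
    ∀ (K : Type) [Field K] [NumberField K], IsImaginaryQuadratic K → NumberField.classNumber K = 1 →
      ∀ (ι : PadicAlgCl 2 ≃+* ℂ) (v vbar : HeightOneSpectrum (𝓞 K)),
        ((2 : ℕ) : 𝓞 K) ∈ v.asIdeal → ((2 : ℕ) : 𝓞 K) ∈ vbar.asIdeal → vbar ≠ v →
        (∀ (w : InfinitePlace K) (k : 𝓞 K), k ∈ v.asIdeal ↔ ‖ι.symm (w.embedding (k : K))‖ < 1) →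
      ∃ (Ω δ : ℂ) (Ωp : (unrIntegers 2)ˣ), Ω ≠ 0 ∧
        (δ ^ 2 = (NumberField.discr K : ℂ) ∨ δ ^ 2 = -(NumberField.discr K : ℂ)) ∧
        ∀ (S : Finset (HeightOneSpectrum (𝓞 K))), v ∉ S → vbar ∉ S →
          ∃ (𝒰 : SubgroupTower (absoluteGaloisGroup K)) (μ : GroupDistribution 𝒰 ℂ_[2]),
            (∀ n, IsOpen (𝒰.U n : Set (absoluteGaloisGroup K))) ∧
            (⋂ n, (𝒰.U n : Set (absoluteGaloisGroup K))) ⊆ DeShalit1987.rayKer K 2 S ∧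
            μ.bound ≤ 1 ∧
            ∀ (ε : HeckeCharacter K) (e : FramedGaloisRep K (PadicAlgCl 2) 1) (m : ℕ),
              IsPAdicAvatarOutside S ι ε e → 3 ≤ m →
              ε.HasInfinityType (fun _ ↦ -(m : ℤ)) (fun _ ↦ ((0 : ℕ) : ℤ)) →
              (∀ w : HeightOneSpectrum (𝓞 K), w ∉ S → w ≠ vbar → ε.IsUnramifiedAt w) →
              𝒰.IsTowerContinuous (fun σ ↦ avatarValueAt e σ) →
              ∀ hL : LFunction.HasEntireContinuation (heckeLFunction ε),
                μ.integral (fun σ ↦ avatarValueAt e σ) =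
                  ((ι.symm (DeShalit1987.interpolationValue 2 v vbar S ε m 0 Ω δ (hL.continuation 0)) :
                      PadicAlgCl 2) : ℂ_[2]) * ((Ωp : unrIntegers 2) : ℂ_[2]) ^ (m + 0) :=
  lMeasureJZero_classNumberOne_two_of_seam (supply_of_chainSeam h24i h24ii h24iii h25 hseam)


end Summit.BirchSwinnertonDyer.BirchSwinnertonDyer.Theorems.PrintCf2.KatzMeasureJZeroTop

end
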